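import Summits.Ventures.CertifiedQuantumChemistry.Rows.ModelPinDiffKeys
import HarnessLib

/-!
# Ventures/CertifiedQuantumChemistry — Rows/ModelPinDiff3Keys.lean: the THREE-TERM difference ROW KEY of record
# `dE3@fcidump:<sha8F>:Na<a>:Nb<b>-<sha8G₁>:Na<a₁>:Nb<b₁>-<sha8G₂>:Na<a₂>:Nb<b₂>` computed from three records
# (sibling of `Rows/ModelPinDiffKeys.lean`; nothing there is edited)

HONEST FRAMING (verbatim): certified bounds for a stated model Hamiltonian in a stated basis; not a
claim about the real molecule or material beyond that model. This file is BOOKKEEPING: a string renderer on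
three `PinnedSector` records and two kernel probes; it certifies nothing and gates no event word (chem-lead A419 (2):
«the `dE3@` key ↔ records lemma lands beside this row — kernel bookkeeping, not a gate on the event word»).

THE GRAMMAR OF RECORD (ORACLE-SPEC «§1.3 ADDENDUM v0.9.7» class `dE3-from-absolutes`; TARGETS v1.12+D3 l.64; chem-lead A414;
chem-ref-3 ACK INBOX l.6361; first row CERTIFIED-CHEM #349): `dE3@fcidump:<sha8F>:Na<a>:Nb<b>-<sha8G₁>:Na<a₁>:Nb<b₁>-<sha8G₂>:Na<a₂>:Nb<b₂>`
names `E₀(H[F]; a, b) − E₀(H[G₁]; a₁, b₁) − E₀(H[G₂]; a₂, b₂)` (`Model.energyDiff3`, Rows/ThreeTermDifferenceRows.lean) — the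
supermolecule FIRST, then the two fragments («complex first; G₁ < G₂ ascending sha» per the referees' spelling of #349), every member
with its OWN sector suffix (the three sectors differ in general), NO `E_core` tag (the TOTAL convention is a row cell, as for `dEKey`).

* `PinnedSector.dE3Key F G₁ G₂` — the renderer; `dE3Key_eq` — spelled out to the occupation numbers;
* `dE3Key_eq_of_sha8` — KERNEL PROBE on the fields of the key of record of row #349: any three records with `sha8` `5d2085ef` /
  `057227a4` / `157cfd52` and sectors (10,9) / (5,5) / (5,4) render LITERALLY `dE3@fcidump:5d2085ef:Na10:Nb9-057227a4:Na5:Nb5-157cfd52:Na5:Nb4`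
  (`decide`). No record of any file is declared here (the three T01 files are k ≤ 16 LITERAL models whose rows carry no `PinnedSector`
  record; the probe is stated over arbitrary records with those fields, exactly as `dEKey_eq_of_sha8`).

Typed by chem-type-07 (B8-1 slot 07, gen 13) beside row #349's Lean cell.
-/

namespace Summit.Ventures.CertifiedQuantumChemistry

namespace PinnedSector

/-- **THREE-TERM DIFFERENCE row key of record**:
`dE3@fcidump:<sha8F>:Na<a>:Nb<b>-<sha8G₁>:Na<a₁>:Nb<b₁>-<sha8G₂>:Na<a₂>:Nb<b₂>`, meaning
`E₀(H[F]; a, b) − E₀(H[G₁]; a₁, b₁) − E₀(H[G₂]; a₂, b₂)` (ORACLE-SPEC §1.3 ADDENDUM v0.9.7, class `dE3-from-absolutes`;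
TARGETS v1.12+D3). Each member carries its own sector suffix; no `E_core` tag. [cite: KnowlesHandy1989, §2 (FCIDUMP format)] -/
def dE3Key (F G₁ G₂ : PinnedSector) : String :=
  "dE3@fcidump:" ++ F.pin.sha8 ++ F.sectorTag ++ "-" ++ G₁.pin.sha8 ++ G₁.sectorTag ++ "-" ++
    G₂.pin.sha8 ++ G₂.sectorTag

/-- `dE3Key` spelled out to the occupation numbers. [cite: KnowlesHandy1989, §2 (FCIDUMP format)] -/
theorem dE3Key_eq (F G₁ G₂ : PinnedSector) :
    dE3Key F G₁ G₂ = "dE3@fcidump:" ++ F.pin.sha8 ++ ":Na" ++ toString F.nalpha ++ ":Nb" ++ toString F.nbeta ++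
      "-" ++ G₁.pin.sha8 ++ ":Na" ++ toString G₁.nalpha ++ ":Nb" ++ toString G₁.nbeta ++
      "-" ++ G₂.pin.sha8 ++ ":Na" ++ toString G₂.nalpha ++ ":Nb" ++ toString G₂.nbeta := by
  simp only [dE3Key, sectorTag, String.append_assoc]

/-- **Probe — the key of record of CERTIFIED-CHEM row #349** (R2-N2 designated pair, form (b), B∞ isolated-fragment reference): for any
three records with the `sha8` / sector fields of T01a `5d2085ef` (10,9), the isolated N₂ `057227a4` (5,5) and the isolated Ni⁺ `157cfd52`
(5,4), `dE3Key` renders LITERALLY `dE3@fcidump:5d2085ef:Na10:Nb9-057227a4:Na5:Nb5-157cfd52:Na5:Nb4` (TARGETS v1.12+D3 l.64; chem-lead A414).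
[cite: KnowlesHandy1989, §2 (FCIDUMP format)] -/
theorem dE3Key_eq_of_sha8 (F G₁ G₂ : PinnedSector) (hF : F.pin.sha8 = "5d2085ef") (hG₁ : G₁.pin.sha8 = "057227a4")
    (hG₂ : G₂.pin.sha8 = "157cfd52") (ha : F.nalpha = 10) (hb : F.nbeta = 9) (ha₁ : G₁.nalpha = 5)
    (hb₁ : G₁.nbeta = 5) (ha₂ : G₂.nalpha = 5) (hb₂ : G₂.nbeta = 4) :
    dE3Key F G₁ G₂ = "dE3@fcidump:5d2085ef:Na10:Nb9-057227a4:Na5:Nb5-157cfd52:Na5:Nb4" := by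
  rw [dE3Key_eq, hF, hG₁, hG₂, ha, hb, ha₁, hb₁, ha₂, hb₂]
  decide

/-- The three-term key is the two-term ACROSS-SECTORS key of `(F, G₁)` with the third member appended (bookkeeping identity with
`dEKeySectors`, up to the `dE`/`dE3` head tag). [cite: KnowlesHandy1989, §2 (FCIDUMP format)] -/
theorem dE3Key_eq_append (F G₁ G₂ : PinnedSector) :
    dE3Key F G₁ G₂ = "dE3@fcidump:" ++ F.pin.sha8 ++ F.sectorTag ++ "-" ++ G₁.pin.sha8 ++ G₁.sectorTag ++
      ("-" ++ G₂.pin.sha8 ++ G₂.sectorTag) := by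
  simp only [dE3Key, String.append_assoc]

end PinnedSector

end Summit.Ventures.CertifiedQuantumChemistry
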